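import Summits.Schanuel.Schanuel.Theorems.RootDecomp1KOnePointCell04

/-!
# RootDecomp1KOnePointCell — lens 1, generation 39 «ONE-POINT ZERO ESTIMATE + LOG-LOG WALL CELL of 33364» ((1, ℓ₂, ℓ₃, ρ) for every log-log-Liouville ρ) — continuation (RootDecomp1KOnePointCell05): §3c tightness of (T) (`tightF`, `tightF_height_excluded`) + §4 `logPowMeasure_of_logLogMeasure`

(lens-1 g39 `RootDecomp1KOnePointCell.lean` [HOME/decomp-schanuel-lens-1/g39/RootDecomp1KOnePointCell.lean sha256 4a1f4bc8…4211, 2530 l + OPprobe + OPctrl + NODE-g39.md; NOTE/CLAIM L1801, ACK + CHECKLIST K-g39 L1803, presearch (6) resolved by the critic L1810, NODE L1824 / REQUEST L1825 / RESULT L1826]; port by census-1 gen 16 in ten parts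
`RootDecomp1KOnePointCell01`–`10` — see the PORT NOTE of part 01; `--supports stmt-Schanuel-33364`; rung 0.)
-/

open Complex IntermediateField Polynomial
open Summit.Schanuel.Schanuel.Theorems.RootDecomp1KHyper
open Summit.Schanuel.Schanuel.Theorems.RootDecomp1KHyper.HyperCell
open Summit.Schanuel.Schanuel.Theorems.RootDecomp1KGeneric
open Summit.Schanuel.Schanuel.Theorems.RootDecomp1KRelLiouvilleCell
open Summit.Schanuel.Schanuel.Theorems.RootDecomp1KLogLogCell
open Summit.Schanuel.Schanuel.Theorems.RootDecomp1KTwoBaseCell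
open Summit.Schanuel.Schanuel.Theorems.RootDecomp1KMeasuredWallCell

namespace Summit.Schanuel.Schanuel.Theorems.RootDecomp1KOnePointCell

section OnePoint
open LiouvilleNumber
open scoped Nat

/-! ### §3c  TIGHTNESS of (T): the `d = 1` family `F_K = 3^{K!}·x − psNumer 3 K` VANISHES at the point -/

/-- The tightness family: `F_K := 3^{K!} x − psNumer 3 K ∈ ℤ[x][y]` (constant in `y`, degree `1` in `x`). -/
noncomputable def tightF (K : ℕ) : ℤ[X][X] :=
  C (C ((3 : ℤ) ^ K !) * X - C ((psNumer 3 K : ℕ) : ℤ))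

/-- `F_K ≠ 0`. -/
theorem tightF_ne_zero (K : ℕ) : tightF K ≠ 0 := by
  unfold tightF
  rw [Ne, Polynomial.C_eq_zero]
  intro h
  have h1 : (C ((3 : ℤ) ^ K !) * X - C ((psNumer 3 K : ℕ) : ℤ)).coeff 1 = (3 : ℤ) ^ K ! := by
    rw [Polynomial.coeff_sub, Polynomial.coeff_C_mul, Polynomial.coeff_X_one, Polynomial.coeff_C,
      if_neg (by norm_num), mul_one, sub_zero]
  rw [h, Polynomial.coeff_zero] at h1
  exact absurd h1.symm (pow_ne_zero _ (by norm_num))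

/-- `evxy` of a polynomial constant in `y`. -/
theorem evxy_C (x₀ y₀ : ℚ) (p : ℤ[X]) : evxy x₀ y₀ (C p) = Polynomial.aeval x₀ p := by
  unfold evxy; rw [Polynomial.map_C, Polynomial.eval_C]; rfl

/-- `F_K` has `y`-degree `0 ≤ 1`. -/
theorem natDegree_tightF_le (K : ℕ) : (tightF K).natDegree ≤ 1 := by
  unfold tightF; rw [Polynomial.natDegree_C]; exact zero_le_one

/-- `F_K` has `x`-degree `≤ 1` in every row. -/
theorem natDegree_coeff_tightF_le (K : ℕ) (i : ℕ) : ((tightF K).coeff i).natDegree ≤ 1 := by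
  unfold tightF
  rw [Polynomial.coeff_C]
  split_ifs
  · refine (Polynomial.natDegree_sub_le _ _).trans (max_le ?_ ?_)
    · exact (Polynomial.natDegree_C_mul_le _ _).trans Polynomial.natDegree_X_le
    · rw [Polynomial.natDegree_C]; exact zero_le_one
  · simp

/-- `F_K` has height `≤ 3^{K!}` (its two coefficients are `3^{K!}` and `−psNumer 3 K`, `0 ≤ psNumer 3 K < 3^{K!}`). -/
theorem abs_coeff_coeff_tightF_le (K : ℕ) (i j : ℕ) :
    |((tightF K).coeff i).coeff j| ≤ (3 : ℤ) ^ K ! := by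
  have hps : ((psNumer 3 K : ℕ) : ℤ) < (3 : ℤ) ^ K ! := psNumer_three_lt K
  have hps0 : (0 : ℤ) ≤ ((psNumer 3 K : ℕ) : ℤ) := by positivity
  unfold tightF
  rw [Polynomial.coeff_C]
  split_ifs
  · rw [Polynomial.coeff_sub, Polynomial.coeff_C_mul, Polynomial.coeff_X, Polynomial.coeff_C]
    rcases Nat.lt_trichotomy j 1 with hj | rfl | hj
    · have hj0 : j = 0 := by omega
      subst hj0
      simp only [show (1 : ℕ) = 0 ↔ False by decide, if_false, mul_zero, zero_sub, if_true, abs_neg]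
      rw [abs_of_nonneg hps0]; exact hps.le
    · simp
    · have h1 : ¬ (1 = j) := by omega
      have h0 : ¬ (j = 0) := by omega
      simp [h1, h0]
  · simp

/-- **`F_K` VANISHES at the one point `(s³_K, s²_K)`** (`3^{K!} · s³_K = psNumer 3 K`). -/
theorem evxy_tightF (K : ℕ) : evxy (psQ 3 K) (psQ 2 K) (tightF K) = 0 := by
  rw [tightF, evxy_C, map_sub, map_mul, Polynomial.aeval_X, Polynomial.aeval_C, Polynomial.aeval_C,
    psQ_eq_div (b := 3) (by norm_num)]
  have h3 : (3 : ℚ) ^ K ! ≠ 0 := by positivity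
  simp only [algebraMap_int_eq, eq_intCast, Int.cast_pow, Int.cast_ofNat, Int.cast_natCast, Nat.cast_ofNat]
  rw [mul_div_assoc', mul_div_cancel_left₀ _ h3, sub_self]

/-- … hence `F_K` VIOLATES the height hypothesis of (T) at every admissible `K` (contrapositive of (T) — the
degree hypotheses hold with `d = 1` and `K ≥ 6³·2 = 432`): `¬ (3^{K!})^{2·6} ≤ 2^{K!}`.  (Directly:
`3^{12 K!} > 2^{K!}`.)  So the exponent `2·6^d` in `L^{2·6^d} ≤ 2^{K!}` cannot be dropped to `0`, and the
height of a vanishing family at scale `K` is `≍ 3^{K!}`: the ONE-POINT estimate is tight up to the constant in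
the exponent, and (M′)'s LOG-LOG loss is genuine for this block (`|F_K(ℓ₃, ·)| = 3^{K!}|ℓ₃ − s³_K| ≍ L^{−K}`). -/
theorem tightF_height_excluded (K : ℕ) : ¬ ((3 : ℤ) ^ K !) ^ (2 * 6 ^ 1) ≤ (2 : ℤ) ^ K ! := by
  intro h
  have h1 : (2 : ℤ) ^ K ! < (3 : ℤ) ^ K ! :=
    pow_lt_pow_left₀ (by norm_num) (by norm_num) (Nat.factorial_pos K).ne'
  have h2 : (3 : ℤ) ^ K ! ≤ ((3 : ℤ) ^ K !) ^ (2 * 6 ^ 1) :=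
    le_self_pow₀ (one_le_pow₀ (by norm_num)) (by norm_num)
  linarith

/-- The same exclusion READ THROUGH (T): at every `K ≥ 432` the family `F_K` is a zero of `evxy` at the point
with `d = 1`, so (T) forces its height hypothesis to fail. -/
theorem tightF_height_excluded' {K : ℕ} (hK : 6 ^ (1 + 2) * (1 + 1) ≤ K) :
    ¬ ((3 : ℤ) ^ K !) ^ (2 * 6 ^ 1) ≤ (2 : ℤ) ^ K ! := fun hL =>
  onePoint_nonvanishing (tightF K) (tightF_ne_zero K) (natDegree_tightF_le K) (natDegree_coeff_tightF_le K)
    (abs_coeff_coeff_tightF_le K) hK hL (evxy_tightF K)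

end OnePoint

/-! ## §4  (M′) THE INDUCED LOG-LOG MEASURE of the block `(ℓ₂, ℓ₃, θ⃗)` — ONE scale, via (T) -/

section BlockMeasure
open LiouvilleNumber
open scoped Nat

variable {n : ℕ}

/-- `6 ≤ e²`. -/
private theorem six_le_exp_two'' : (6 : ℝ) ≤ Real.exp 2 := by
  have h : Real.exp 2 = Real.exp 1 ^ 2 := by rw [← Real.exp_nat_mul]; norm_num
  rw [h]
  have h1 := Real.exp_one_gt_d9
  calc (6 : ℝ) ≤ (2.7182818283 : ℝ) ^ 2 := by norm_num
    _ ≤ Real.exp 1 ^ 2 := pow_le_pow_left₀ (by norm_num) h1.le 2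

/-- **Comparison of the two tree classes** (checklist (2)): a LOG-LOG measure is a LOG-POWER measure (exponent
`k = 2`, same constant), since `1 + log(1 + log L) ≤ 1 + log L`.  So (M′) below RE-DERIVES g38's block measure
`RootDecomp1KMeasuredWallCell.logPowMeasure_cons_two_three` (positive control in the probe). -/
theorem logPowMeasure_of_logLogMeasure {θ : Fin n → ℂ} (h : LogLogMeasure θ) : LogPowMeasure θ := by
  intro d
  obtain ⟨C, hC, hP⟩ := h d
  refine ⟨C, 2, hC, fun P hP0 hdeg => le_trans (Real.exp_le_exp.mpr (neg_le_neg ?_)) (hP P hP0 hdeg)⟩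
  set L : ℝ := ((mvlen P : ℤ) : ℝ) with hLdef
  have hL1 : 1 ≤ L := by rw [hLdef]; exact_mod_cast one_le_mvlen hP0
  have hlog0 : 0 ≤ Real.log L := Real.log_nonneg hL1
  set u : ℝ := 1 + Real.log L with hudef
  have hu0 : 0 < u := by rw [hudef]; linarith
  have hv : 1 + Real.log u ≤ u := by
    have := Real.add_one_le_exp (Real.log u)
    rw [Real.exp_log hu0] at this
    linarith
  calc C * u * (1 + Real.log u) ≤ C * u * u := mul_le_mul_of_nonneg_left hv (by positivity)
    _ = C * u ^ 2 := by ring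

end BlockMeasure

end Summit.Schanuel.Schanuel.Theorems.RootDecomp1KOnePointCell
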